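import Mathlib

/-!
# A sub-unit positive kernel is dominated by the diagonal: `Re ∫∫ K ⟨χ, χ⟩ ≤ ∫ ‖χ‖²`
(crux `QuarksAsStableAction.StableActionBridge`, item stmt-QuantumFields-9737, line `Sketch`;
registered stub `re_double_integral_kernel_dotProduct_le` of the lead skeleton — the abstract
measure-theoretic core of the BOUNDEDNESS of the Rayleigh quotient
`R(Ψ) = Re 𝔱(Ψ,Ψ) / Re 𝔫(Ψ,Ψ)` behind `qcdTransferLevel` / `qcdTransferGap`, i.e. of the fact that
Lüscher's transfer matrix `T̂` is a bounded operator)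

For a probability space `(X, μ)`, a finite index type `ι`, a real kernel `K` with
`0 ≤ K ≤ 1` and a bounded measurable vector-valued `χ : X → ι → ℂ` we prove

  `Re ∫ₓ ∫ᵧ K(x, y) · ⟨χ x, χ y⟩ dμ dμ ≤ ∫ₓ Re ⟨χ x, χ x⟩ dμ = ∫ₓ ∑ᵢ |χ x i|² dμ`,

where `⟨u, v⟩ = star u ⬝ᵥ v = ∑ᵢ conj (u i) · v i`.  In the application `X` is the space of link
configurations on a time slice with product Haar measure, `K` is the (normalised) Wilson
pure-gauge transfer kernel and `χ(U) = T̂_F(U) Ψ(U)` is Fock-vector valued.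

Proof (no Cauchy–Schwarz in `L²` is needed): pointwise, by `|K| ≤ 1`, the triangle inequality and
`2ab ≤ a² + b²`,

  `‖K(x, y) ⟨χ x, χ y⟩‖ ≤ ∑ᵢ |χ x i| |χ y i| ≤ (a x + a y) / 2`,  `a x := ∑ᵢ |χ x i|² = Re ⟨χ x, χ x⟩`;

then `Re ∫∫ F ≤ ‖∫∫ F‖ ≤ ∫ₓ ‖∫ᵧ F‖ ≤ ∫ₓ ∫ᵧ (a x + a y)/2 = (∫ a + ∫ a)/2 = ∫ a`
(`norm_integral_le_integral_norm` is unconditional and `integral_mono_of_nonneg` only needs the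
dominating side to be integrable, which it is: `a` is bounded and measurable on a finite measure
space).  In particular no integrability of the integrand `F` — hence no measurability of `K` — is
used: the joint measurability hypothesis of the registered signature is kept but not needed (a
non-integrable section only makes the corresponding Bochner integral `0`).

Mathlib only. [folklore]
-/

noncomputable section

open MeasureTheory Matrix
open scoped ComplexConjugate BigOperators

namespace Summit.QuantumFields.QCD.Cruxes.StableActionBridge.Sketch

/-- The hermitian square of a complex vector is the sum of the squared moduli of its entries:
`Re (star v ⬝ᵥ v) = ∑ᵢ ‖v i‖²`. [folklore] -/
private theorem re_star_dotProduct_self_eq_sum {ι : Type} [Fintype ι] (v : ι → ℂ) :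
    (star v ⬝ᵥ v).re = ∑ i, ‖v i‖ ^ 2 := by
  simp only [dotProduct, Pi.star_apply, Complex.star_def, Complex.conj_mul', Complex.re_sum,
    ← Complex.ofReal_pow, Complex.ofReal_re]

/-- Triangle inequality for the hermitian pairing: `‖star v ⬝ᵥ w‖ ≤ ∑ᵢ ‖v i‖ · ‖w i‖`.
[folklore] -/
private theorem norm_star_dotProduct_le_sum {ι : Type} [Fintype ι] (v w : ι → ℂ) :
    ‖star v ⬝ᵥ w‖ ≤ ∑ i, ‖v i‖ * ‖w i‖ := by
  simp only [dotProduct, Pi.star_apply, Complex.star_def]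
  refine (norm_sum_le _ _).trans (le_of_eq ?_)
  refine Finset.sum_congr rfl fun i _ => ?_
  rw [norm_mul, Complex.norm_conj]

/-- Arithmetic–geometric mean bound for the hermitian pairing:
`‖star v ⬝ᵥ w‖ ≤ (∑ᵢ ‖v i‖² + ∑ᵢ ‖w i‖²) / 2`. [folklore] -/
private theorem norm_star_dotProduct_le_half_add {ι : Type} [Fintype ι] (v w : ι → ℂ) :
    ‖star v ⬝ᵥ w‖ ≤ ((∑ i, ‖v i‖ ^ 2) + ∑ i, ‖w i‖ ^ 2) / 2 := by
  refine (norm_star_dotProduct_le_sum v w).trans ?_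
  rw [le_div_iff₀ (two_pos : (0 : ℝ) < 2), ← Finset.sum_add_distrib, Finset.sum_mul]
  refine Finset.sum_le_sum fun i _ => ?_
  have h := two_mul_le_add_sq ‖v i‖ ‖w i‖
  linarith

/-- Pointwise domination of the kernel integrand by the symmetrised diagonal: for `0 ≤ k ≤ 1`,
`‖(k : ℂ) · (star v ⬝ᵥ w)‖ ≤ (∑ᵢ ‖v i‖² + ∑ᵢ ‖w i‖²) / 2`. [folklore] -/
private theorem norm_ofReal_mul_star_dotProduct_le {ι : Type} [Fintype ι] (k : ℝ) (hk0 : 0 ≤ k)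
    (hk1 : k ≤ 1) (v w : ι → ℂ) :
    ‖((k : ℝ) : ℂ) * (star v ⬝ᵥ w)‖ ≤ ((∑ i, ‖v i‖ ^ 2) + ∑ i, ‖w i‖ ^ 2) / 2 := by
  rw [norm_mul, Complex.norm_real, Real.norm_of_nonneg hk0]
  have h := norm_star_dotProduct_le_half_add v w
  have h0 : 0 ≤ ‖star v ⬝ᵥ w‖ := norm_nonneg _
  nlinarith

/-- **A sub-unit positive kernel is dominated by the diagonal.** For a probability measure `μ`
on `X`, a finite index type `ι`, a real kernel `0 ≤ K ≤ 1` and a bounded, componentwise measurable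
`χ : X → ι → ℂ`,
`Re ∫ₓ ∫ᵧ K(x, y) · (star (χ x) ⬝ᵥ χ y) dμ dμ ≤ ∫ₓ Re (star (χ x) ⬝ᵥ χ x) dμ`.
Route: `Re z ≤ ‖z‖`, `‖∫ f‖ ≤ ∫ ‖f‖` twice, the pointwise bound
`‖K(x, y) ⟨χ x, χ y⟩‖ ≤ (a x + a y)/2` with `a x = ∑ᵢ ‖χ x i‖² = Re ⟨χ x, χ x⟩`, and
`∫ₓ ∫ᵧ (a x + a y)/2 = ∫ a` for a probability measure.  (The joint measurability of `K` in the
registered signature is not needed for the inequality.) [folklore] -/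
theorem re_double_integral_kernel_dotProduct_le : ∀ (X : Type) [MeasurableSpace X] (μ : Measure X) [IsProbabilityMeasure μ] (ι : Type) [Fintype ι] (K : X → X → ℝ) (χ : X → ι → ℂ), (∀ x y, 0 ≤ K x y) → (∀ x y, K x y ≤ 1) → Measurable (Function.uncurry K) → (∃ C : ℝ, ∀ x i, ‖χ x i‖ ≤ C) → (∀ i, Measurable fun x => χ x i) → (∫ x, ∫ y, ((K x y : ℝ) : ℂ) * (star (χ x) ⬝ᵥ χ y) ∂μ ∂μ).re ≤ ∫ x, (star (χ x) ⬝ᵥ χ x).re ∂μ := by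
  intro X _ μ _ ι _ K χ hK0 hK1 _hKm hχb hχm
  obtain ⟨C, hC⟩ := hχb
  -- the diagonal `a x = Re ⟨χ x, χ x⟩ = ∑ i ‖χ x i‖²`
  set a : X → ℝ := fun x => (star (χ x) ⬝ᵥ χ x).re
  have ha_eq : ∀ x, a x = ∑ i, ‖χ x i‖ ^ 2 := fun x => re_star_dotProduct_self_eq_sum (χ x)
  have ha_nonneg : ∀ x, 0 ≤ a x := fun x => by
    rw [ha_eq]
    exact Finset.sum_nonneg fun i _ => sq_nonneg _
  have ha_meas : Measurable a := by
    have h : a = fun x => ∑ i, ‖χ x i‖ ^ 2 := funext ha_eq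
    rw [h]
    exact Finset.measurable_sum _ fun i _ => ((hχm i).norm).pow_const 2
  have ha_bound : ∀ x, ‖a x‖ ≤ ∑ _i : ι, C ^ 2 := by
    intro x
    rw [Real.norm_of_nonneg (ha_nonneg x), ha_eq]
    refine Finset.sum_le_sum fun i _ => ?_
    have h0 : 0 ≤ ‖χ x i‖ := norm_nonneg _
    have h1 := hC x i
    nlinarith
  have ha_int : Integrable a μ :=
    Integrable.of_bound ha_meas.aestronglyMeasurable _ (Filter.Eventually.of_forall ha_bound)
  -- pointwise bound on the integrand
  have hF : ∀ x y, ‖((K x y : ℝ) : ℂ) * (star (χ x) ⬝ᵥ χ y)‖ ≤ (a x + a y) / 2 := by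
    intro x y
    rw [ha_eq, ha_eq]
    exact norm_ofReal_mul_star_dotProduct_le (K x y) (hK0 x y) (hK1 x y) (χ x) (χ y)
  -- the inner integrals
  have h_inner : ∀ x, ‖∫ y, ((K x y : ℝ) : ℂ) * (star (χ x) ⬝ᵥ χ y) ∂μ‖ ≤
      a x / 2 + (∫ y, a y ∂μ) / 2 := by
    intro x
    calc ‖∫ y, ((K x y : ℝ) : ℂ) * (star (χ x) ⬝ᵥ χ y) ∂μ‖
        ≤ ∫ y, (a x + a y) / 2 ∂μ :=
          norm_integral_le_of_norm_le (((integrable_const (a x)).add ha_int).div_const 2)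
            (Filter.Eventually.of_forall (hF x))
      _ = a x / 2 + (∫ y, a y ∂μ) / 2 := by
          rw [integral_div, integral_add (integrable_const (a x)) ha_int, integral_const]
          simp [add_div]
  -- the outer integral
  calc (∫ x, ∫ y, ((K x y : ℝ) : ℂ) * (star (χ x) ⬝ᵥ χ y) ∂μ ∂μ).re
      ≤ ‖∫ x, ∫ y, ((K x y : ℝ) : ℂ) * (star (χ x) ⬝ᵥ χ y) ∂μ ∂μ‖ := Complex.re_le_norm _
    _ ≤ ∫ x, (a x / 2 + (∫ y, a y ∂μ) / 2) ∂μ :=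
          norm_integral_le_of_norm_le ((ha_int.div_const 2).add (integrable_const _))
            (Filter.Eventually.of_forall h_inner)
    _ = ∫ x, a x ∂μ := by
          rw [integral_add (ha_int.div_const 2) (integrable_const _), integral_const,
            integral_div]
          simp only [probReal_univ, smul_eq_mul, one_mul]
          ring

end Summit.QuantumFields.QCD.Cruxes.StableActionBridge.Sketch

end
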